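import Summits.CriticalPhenomena.Ising3DConformalLimit.Theorems.HyperoctahedralRPExistsScaleCovariantLimitFoldedCurrentUniqueness
import Summits.CriticalPhenomena.Ising3DConformalLimit.Theses.PositivityBegetsConformality
import Summits.CriticalPhenomena.Ising3DConformalLimit.Theses.GaussianScaleMixture
import Summits.CriticalPhenomena.Ising3DConformalLimit.Theses.HyperoctahedralRP
import HarnessLib

/-!
# Split glue for the crux `ExistsScaleCovariantLimit` (item stmt-CriticalPhenomena-1981):
# crux ⟸ item 6150 `TwoPointDoubling` ∧ item 4659 `ClusterSetTotallyDisconnected` (and ⟺), for every route copy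

Crux-strategist decomposition (unit `cstrat-stmt-CriticalPhenomena-1981-s1`, 2026-08-17) of the shared existence crux of routes
`PositivityBegetsConformality` (crux #4 `(E₀)`), `GaussianScaleMixture` and `HyperoctahedralRP` of `CriticalPhenomena/Ising3DConformalLimit`:

  `ExistsScaleCovariantLimit := ∃ ρ Δ S, ρ > 0 ∧ Δ > 0 ∧ HasPointwiseScalingLimit (criticalCorr 3) ρ S ∧ S = 0 off NonCoincident ∧
     IsNondegenerateTwoPoint S ∧ IsTranslationInvariant S ∧ IsScaleCovariant Δ S`

(existence of the full scaling limit of the critical `ℤ³` Ising correlations, rotations excluded; H. Duminil-Copin, ICM 2022 §8.4: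
"widely open") is split into the two items that five consecutive line leads (c9, c11–c14) identified as its exact content:

* `Sub₁` = item stmt-CriticalPhenomena-6150 `MirrorHoelderCompactness.TwoPointDoubling` — all-scale doubling `κ·g(n) ≤ g(2n)` of the axial
  critical two-point function (the COMPACTNESS half: ⟺ item 5955 `OrbitPrecompact` ⟺ item 4658 `UniformRegularity`, `orbitPrecompact_iff_doubling`,
  p120504; open: Aizenman–Duminil-Copin, Ann. Math. 194 (2021), arXiv:1912.07973 Remark 5.10);
* `Sub₂` = item stmt-CriticalPhenomena-4659 `ClusterRigidity.ClusterSetTotallyDisconnected` — the cluster set of the self-normalised critical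
  correlators is totally disconnected in the product topology (the IDENTIFICATION half: under 5955 it is EQUIVALENT to uniqueness of the pinned
  cluster point, `clusterPointUnique_iff_clusterSetTotallyDisconnected`, p139907).

This file lands the split glue in the exact shape `Sub₁ → Sub₂ → Crux` consumed by `ledger route edit --split … --glue-by`, for each of the
three route copies of the shared decl (the three `def`s have the same body; one proof term serves all by `δ`-unfolding), together with the
converse (`subs_of_ExistsScaleCovariantLimit`: the split is LOSSLESS — crux ⟺ Sub₁ ∧ Sub₂), all by one-line logic from the landed
`FoldedCurrentRepulsion.crux_iff_doubling_and_totallyDisconnected` (p139907). Neither child is the crux reworded: Sub₁ is two-point-only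
(the discretely self-similar witness `W_ε` of `Literature…PointwiseScalingLimitDiscreteScaleInvariance` satisfies Sub₁ and has no limit), and
Sub₂ holds vacuously along scales where the pinned zoom has no locally uniform cluster point, so it does not imply Sub₁ (crux NOTES.md, census
§Decomposition). No definitions, no `sorry`.

References: [DuminilCopinICM2022] §8.4; [AizenmanDuminilCopinAnnals2021] Remark 5.10; S. Rychkov, C. R. Physique 21 (2020) p. 8 (isolation of
local CFTs — the intended engine of item 4659) [Rychkov2020].
-/

noncomputable section

namespace Summit.CriticalPhenomena.Ising3DConformalLimit.Cruxes.ExistsScaleCovariantLimit.Split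

open Summit.CriticalPhenomena.Ising3DConformalLimit.Theses
open Summit.CriticalPhenomena.Ising3DConformalLimit.Cruxes.ExistsScaleCovariantLimit.FoldedCurrentRepulsion
  (crux_iff_doubling_and_totallyDisconnected)

/-- **crux ⟺ item 6150 ∧ item 4659** at route PositivityBegetsConformality's copy (crux #4 `(E₀)`; the `def`s
`PositivityBegetsConformality.ExistsScaleCovariantLimit` and `HyperoctahedralRP.ExistsScaleCovariantLimit` have the same body, so the landed
`crux_iff_doubling_and_totallyDisconnected` (p139907) is accepted at this type by `δ`-unfolding). [folklore] -/
theorem ExistsScaleCovariantLimit_iff_subs :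
    PositivityBegetsConformality.ExistsScaleCovariantLimit ↔
      MirrorHoelderCompactness.TwoPointDoubling ∧ ClusterRigidity.ClusterSetTotallyDisconnected :=
  crux_iff_doubling_and_totallyDisconnected

/-- **The split is lossless**: the crux implies both children (so a refutation of EITHER child refutes the crux at every route copy,
and the parent node carries no content beyond `Sub₁ ∧ Sub₂`). [folklore] -/
theorem subs_of_ExistsScaleCovariantLimit (h : PositivityBegetsConformality.ExistsScaleCovariantLimit) :
    MirrorHoelderCompactness.TwoPointDoubling ∧ ClusterRigidity.ClusterSetTotallyDisconnected :=
  ExistsScaleCovariantLimit_iff_subs.1 h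

/-- **crux ⟺ item 6150 ∧ item 4659** at route GaussianScaleMixture's copy (crux `(E)`). [folklore] -/
theorem ExistsScaleCovariantLimit_iff_subs_gsm :
    GaussianScaleMixture.ExistsScaleCovariantLimit ↔
      MirrorHoelderCompactness.TwoPointDoubling ∧ ClusterRigidity.ClusterSetTotallyDisconnected :=
  -- `GaussianScaleMixture.ExistsScaleCovariantLimit` has the same body as PositivityBegetsConformality's copy (`δ`-unfolding)
  ⟨fun h => subs_of_ExistsScaleCovariantLimit h, fun h => ExistsScaleCovariantLimit_iff_subs.2 h⟩

/-- **SPLIT GLUE (route PositivityBegetsConformality's copy)**: item 6150 → item 4659 → the crux — the shape consumed by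
`ledger route edit --split ExistsScaleCovariantLimit --into … --glue-by`. [folklore] -/
theorem ExistsScaleCovariantLimit_of_subs (h₁ : MirrorHoelderCompactness.TwoPointDoubling)
    (h₂ : ClusterRigidity.ClusterSetTotallyDisconnected) :
    PositivityBegetsConformality.ExistsScaleCovariantLimit :=
  ExistsScaleCovariantLimit_iff_subs.2 ⟨h₁, h₂⟩

/-- **SPLIT GLUE (route GaussianScaleMixture's copy)**: item 6150 → item 4659 → the crux. [folklore] -/
theorem ExistsScaleCovariantLimit_of_subs_gsm (h₁ : MirrorHoelderCompactness.TwoPointDoubling)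
    (h₂ : ClusterRigidity.ClusterSetTotallyDisconnected) :
    GaussianScaleMixture.ExistsScaleCovariantLimit :=
  ExistsScaleCovariantLimit_iff_subs_gsm.2 ⟨h₁, h₂⟩

/-- **SPLIT GLUE (route HyperoctahedralRP's copy)**: item 6150 → item 4659 → the crux. [folklore] -/
theorem ExistsScaleCovariantLimit_of_subs_hrp (h₁ : MirrorHoelderCompactness.TwoPointDoubling)
    (h₂ : ClusterRigidity.ClusterSetTotallyDisconnected) :
    HyperoctahedralRP.ExistsScaleCovariantLimit :=
  crux_iff_doubling_and_totallyDisconnected.2 ⟨h₁, h₂⟩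

end Summit.CriticalPhenomena.Ising3DConformalLimit.Cruxes.ExistsScaleCovariantLimit.Split

end
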